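/-
Copyright (c) 2026. All rights reserved.
Released under Apache 2.0 license as described in the file LICENSE.
Authors: abc-iut cell, seat abc-iut-L4-t10 (gen 2; row C45-M0 of plan/L4/SUBDAG-AbsTopIII-Cor45.md:
the MODEL of [AbsTopIII] Cor 4.5 — Def 4.1 (iv), (v) and the input data of Cor 4.5, part 3/3).
-/
import Literature.AnabelianGeometry.AbsoluteAnabelian.ArchimedeanHolPairs
import Literature.AnabelianGeometry.AbsoluteAnabelian.AbsTopIII.FrobeniusPictureMLFTelecore
import Mathlib.CategoryTheory.InducedCategory
import Mathlib.CategoryTheory.Types.Basic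
import HarnessLib

/-!
# [AbsTopIII] Def 4.1 (iv), (v) / Cor 4.5: the archimedean log-Frobenius data as a `LogFrobeniusData`

S. Mochizuki, *Topics in absolute anabelian geometry III*, §4, Def 4.1 (iv) pp. 103–105, (v) p. 105,
Prop 4.2 (ii) p. 106, Cor 4.5 pp. 107–108, kurims manuscript (lit key `paper:url-5493eb38cbb7`, read on
the page; bib key `MochizukiAbsTopIII2015`).  Part 3/3 of the MODEL of Cor 4.5 (cell sub-DAG row C45-M0)
over `𝔄 : AutHolFieldFunctor` (Cor 2.7 (e) + functoriality) and the categories `𝒳 = 𝒞^hol_TF = HolTFPair 𝔄`,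
`𝒩 = 𝒞^hol_TH = HolTHPair 𝔄` of parts 1–2.  REAL functors and natural transformations:
* Def 4.1 (iv): `𝔩𝔬𝔤_{TF,TF}` — in the tree's realisation of the universal covering (`univCover`:
  `k~ := (k, +)`, `log_k = id`, covering map `exp_k`) the field `k~` IS `k` and, by the printed
  characterisation of `κ_{k~}` (its co-holomorphicization is the one of `k~ ↠ k^× ↪ k` composed with
  `κ_k`'s: `exp` is holomorphic in the chart `κ_k` on both sides), `κ_{k~} = κ_k`; so `𝔩𝔬𝔤_{TF,TF}` is the
  identity functor ON THE NOSE (`logFunctor`; Prop 4.2 (ii) with the identity isomorphism), and the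
  content of (iv) is carried by `λ^× : (𝕏 ↶ k) ↦ (𝕏 ↶ k^×)`, `λ^∼ : (𝕏 ↶ k) ↦ (𝕏 ↶ k~)` (`lamTimes`,
  `lamSim`), `ι_log : λ^× ∘ 𝔩𝔬𝔤 → λ^∼` "induced by the natural inclusion `(k~)^× ↪ k~`" and `ι_× : λ^∼ → λ^×`
  "induced by the natural map `k~ ↠ k^×`" (`iotaLog`, `iotaTimes`; the latter IS `exp_k` on arithmetic
  data — a morphism of `𝒞^hol_TH` since `exp` is holomorphic with nowhere-vanishing derivative in the
  Kummer charts, natural since continuous field homomorphisms of CAFs commute with `exp`);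
* Def 4.1 (v): `LinHol` — pairs `(𝕏, 𝕏 ↶ 𝒜_𝕏)`, morphisms "induced by the [finite étale] morphisms of
  `EA`" (`LinHolObj`, `LinHol` = Mathlib `InducedCategory`); `κ_LH : EA ⥲ LinHol` with quasi-inverse the
  projection ("as is easily verified" — verified: `linHolEquivalence`);
* Cor 4.5 (ii): `φ_LH : LinHol → 𝒳`, `(𝕏, 𝕏 ↶ 𝒜_𝕏) ↦ (𝕏 ↶ 𝒜_𝕏)`, an equivalence with quasi-inverse
  `π_LH = (𝒳 → EA) ⋙ κ_LH`, and `η_LH : φ_LH ∘ π_LH ⥲ id_𝒳` (`φLH`, `φLH_isEquivalence`, `πLH`, `ηLH`);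
* the assembled input data of Cor 4.5: `archLogFrobeniusData 𝔄 : LogFrobeniusData.{u+1}` (first row
  `= 𝒳`, `id_⋎ = 𝟭`, `ι_×` in the RIGHT summand, Rmk 4.5.2) and the first-row telecore data
  `archTelecoreData 𝔄 = ⟨φ_LH, unitor, η_LH⟩` consumed by abc-iut-L4-t5's `TelecoreStmt`;
* bookkeeping for the proofs file: `HolTFPair.etaIso`, `HolTHPair.forget` (underlying arithmetic datum).

Scope: `T = TF` (the `TM` twin replaces `k` by `𝒪_k^⊳` — TODO(general form)); `𝒞^hol_TH` restricted to
arithmetic data presented inside CAFs.  Refereed pre-IUT anabelian geometry; a MODEL (kernel definitions)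
over a named interface; nothing is asserted about the geometric existence of `𝔄`; nothing here bears on
[IUTchIII] Cor. 3.12; typed ≠ discharged.
-/

set_option autoImplicit false

noncomputable section

namespace Literature.AnabelianGeometry.AbsoluteAnabelian

open _root_.CategoryTheory _root_.Topology

universe u

variable {𝔄 : AutHolFieldFunctor.{u}}

/-- A CAF is connected (so `k~ = k` is a connected arithmetic datum). [cite: MochizukiAbsTopIII2015, Definition 4.1 (i) p.101] -/
theorem IsCAF.isConnected_univ {k : Type u} [NormedField k] (hk : IsCAF k) :
    IsConnected (Set.univ : Set k) := by
  obtain ⟨e, -, he'⟩ := hk.exists_equiv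
  have h := (_root_.isConnected_univ (α := ℂ)).image _ he'.continuousOn
  rwa [Set.image_univ_of_surjective e.symm.surjective] at h

/-- **Continuous field homomorphisms between CAFs commute with the universal coverings** `k~ ↠ k^×`
(realised as `exp_k`): `f (exp_{k₁} x) = exp_{k₂} (f x)` — the naturality of `ι_×` on arithmetic data.
[cite: MochizukiAbsTopIII2015, Definition 4.1 (iv) p.104] -/
theorem IsCAF.map_univCover {k₁ k₂ : Type u} [NormedField k₁] [NormedField k₂] [CharZero k₁]
    [CharZero k₂] (hk : IsCAF k₁) (f : k₁ →+* k₂) (hf : Continuous f) (x : k₁) :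
    f (univCover k₁ x) = univCover k₂ (f x) := by
  obtain ⟨e, -, he'⟩ := hk.exists_equiv
  rw [IsCAF.univCover_eq e he' x]
  have h := NormedSpace.map_exp (f.comp e.symm.toRingHom) (hf.comp he') (e x)
  simp only [RingHom.comp_apply, RingEquiv.toRingHom_eq_coe, RingEquiv.coe_toRingHom,
    RingEquiv.symm_apply_apply] at h
  unfold univCover
  rw [Complex.exp_eq_exp_ℂ]
  exact h

namespace HolTFPair

/-! ### `η_LH` componentwise; `EA ⥤ 𝒞^hol_TF` is an equivalence -/

/-- `η_LH` at an object, as an isomorphism `(𝕏 ↶ 𝒜_𝕏) ≅ (𝕏 ↶ k)` ("the tautological isomorphism arising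
from the definitions"). [cite: MochizukiAbsTopIII2015, Corollary 4.5 (ii) p.108] -/
def etaIso (P : HolTFPair 𝔄) : (ofEA 𝔄).obj P.X ≅ P where
  hom := ofOfEA P
  inv := toOfEA P
  hom_inv_id := by apply Hom.ext_of_base; simp
  inv_hom_id := by apply Hom.ext_of_base; simp

variable (𝔄) in
/-- `η_LH` read on `EA`: `(𝒳 → EA) ⋙ (𝕏 ↦ (𝕏 ↶ 𝒜_𝕏)) ≅ 𝟭_𝒳`, natural in the pair.
[cite: MochizukiAbsTopIII2015, Corollary 4.5 (ii) p.108] -/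
def etaEA : toEA 𝔄 ⋙ ofEA 𝔄 ≅ 𝟭 (HolTFPair 𝔄) :=
  NatIso.ofComponents (fun P => etaIso P) (fun {P Q} φ => by
    apply Hom.ext_of_base
    change φ.base ≫ 𝟙 Q.X = 𝟙 P.X ≫ φ.base
    rw [Category.comp_id, Category.id_comp])

variable (𝔄) in
/-- `𝕏 ↦ (𝕏 ↶ 𝒜_𝕏)` is an equivalence `EA ⥲ 𝒞^hol_TF` with quasi-inverse `(𝕏 ↶ k) ↦ 𝕏` (the `EA`-form of
Cor 4.5 (ii): "`φ_LH` … is an equivalence of categories, a quasi-inverse for which is given by … the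
natural projection functor"). [cite: MochizukiAbsTopIII2015, Corollary 4.5 (ii) p.108] -/
theorem ofEA_isEquivalence : (ofEA 𝔄).IsEquivalence :=
  Functor.IsEquivalence.mk' (toEA 𝔄) (eqToIso (ofEA_comp_toEA (𝔄 := 𝔄)).symm) (etaEA 𝔄)

/-! ### Definition 4.1 (iv): `𝔩𝔬𝔤_{TF,TF}`, `λ^×`, `λ^∼`, `ι_log`, `ι_×` -/

variable (𝔄) in
/-- **Def 4.1 (iv): the log-Frobenius functor `𝔩𝔬𝔤_{TF,TF} : 𝒞^hol_TF → 𝒞^hol_TF`**,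
`(k, κ_k) ↦ (k~, κ_{k~})`.  In the tree's realisation of the universal covering (`univCover`: `k~ = (k,+)`
with the field structure of `k` transported by `log_k = id`, covering map `exp_k`) and with `κ_{k~}`
pinned among the two `k~`-Kummer structures by the printed characterisation (compatibility of
co-holomorphicizations with `k~ ↠ k^× ↪ k` — `exp_k` is holomorphic in the chart `κ_k` on both sides, so
`κ_{k~} = κ_k`, not its conjugate), this functor is the identity functor on the nose.
[cite: MochizukiAbsTopIII2015, Definition 4.1 (iv) p.104] -/
def logFunctor : HolTFPair 𝔄 ⥤ HolTFPair 𝔄 := 𝟭 (HolTFPair 𝔄)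

/-- The `TH`-pair `(𝕏 ↶ M)` cut out of a `TF`-pair `(𝕏 ↶ k)` by a connected open `M ⊆ k`, with the
co-holomorphicization determined by `κ` (used for `M = k^×` and `M = k~`).
[cite: MochizukiAbsTopIII2015, Definition 4.1 (iv) p.104] -/
def restrictTH (P : HolTFPair 𝔄) (M : Set P.k) (hM : IsOpen M) (hM' : IsConnected M) : HolTHPair 𝔄 where
  X := P.X
  k := P.k
  isCAF := P.isCAF
  carrier := M
  isOpen_carrier := hM
  isConnected_carrier := hM'
  c := P.κ
  continuous_c := P.continuous_κ
  continuous_c_symm := P.continuous_κ_symm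

/-- A morphism of `TF`-pairs restricts to the `TH`-pairs cut out by `M ⊆ k`, `M' ⊆ k'` whenever
`φ_M(M) ⊆ M'`: its coordinate expression in the Kummer charts is the identity (compatibility with the
Kummer structures). [cite: MochizukiAbsTopIII2015, Definition 4.1 (iv) p.104] -/
def Hom.restrictTH {P Q : HolTFPair 𝔄} (φ : P ⟶ Q) {M : Set P.k} {hM : IsOpen M} {hM' : IsConnected M}
    {M' : Set Q.k} {hN : IsOpen M'} {hN' : IsConnected M'} (h : ∀ x ∈ M, φ.arith x ∈ M') :
    P.restrictTH M hM hM' ⟶ Q.restrictTH M' hN hN' where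
  base := φ.base
  toFun x := φ.arith x.1
  mem x := h x.1 x.2
  hol e he he' :=
    IsHolLocIso.of_eq_id ((P.restrictTH M hM hM').chart_injective _ e)
      ((P.restrictTH M hM hM').isOpen_chart_image _ e he he') (fun x => by
        change e (𝔄.Amap (𝟙 Q.X) (Q.κ (φ.arith x.1))) = e (𝔄.Amap φ.base (P.κ x.1))
        rw [𝔄.Amap_id_apply, φ.compat])

variable (𝔄) in
/-- **Def 4.1 (iv): `λ^× : 𝒞^hol_TF → 𝒞^hol_TH`**, "`(k, κ_k) ↦` (the Aut-holomorphic space `k^×`, with its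
Kummer structure `[κ_k|_{k^×}]`)". [cite: MochizukiAbsTopIII2015, Definition 4.1 (iv) p.104] -/
def lamTimes : HolTFPair 𝔄 ⥤ HolTHPair 𝔄 where
  obj P := P.restrictTH {x | x ≠ 0} isOpen_ne P.isCAF.isConnected_ne_zero
  map φ := Hom.restrictTH φ (fun x hx => by
    simpa only [Set.mem_setOf_eq, map_ne_zero_iff _ φ.arith.injective] using hx)
  map_id P := by apply HolTHPair.Hom.ext <;> rfl
  map_comp φ ψ := by apply HolTHPair.Hom.ext <;> rfl

variable (𝔄) in
/-- **Def 4.1 (iv): `λ^∼ : 𝒞^hol_TF → 𝒞^hol_TH`**, "`(k, κ_k) ↦` (the Aut-holomorphic space `k~`, with its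
Kummer structure `[κ_{k~}]`)" (`k~ = (k,+)` in the tree's realisation).
[cite: MochizukiAbsTopIII2015, Definition 4.1 (iv) p.104] -/
def lamSim : HolTFPair 𝔄 ⥤ HolTHPair 𝔄 where
  obj P := P.restrictTH Set.univ isOpen_univ P.isCAF.isConnected_univ
  map φ := Hom.restrictTH φ (fun _ _ => Set.mem_univ _)
  map_id P := by apply HolTHPair.Hom.ext <;> rfl
  map_comp φ ψ := by apply HolTHPair.Hom.ext <;> rfl

/-- `λ^×`, `λ^∼` on morphisms act by `φ_M` on arithmetic data. [cite: MochizukiAbsTopIII2015, Definition 4.1 (iv) p.104] -/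
theorem lam_map_toFun {P Q : HolTFPair 𝔄} (φ : P ⟶ Q) :
    (∀ x, ((lamTimes 𝔄).map φ).toFun x = φ.arith x.1) ∧ ∀ x, ((lamSim 𝔄).map φ).toFun x = φ.arith x.1 :=
  ⟨fun _ => rfl, fun _ => rfl⟩

/-- **`ι_log` at a pair**: the morphism `λ^×(𝔩𝔬𝔤(𝕏 ↶ k)) = (𝕏 ↶ (k~)^×) → (𝕏 ↶ k~) = λ^∼(𝕏 ↶ k)` "induced by
the natural inclusion `(k~)^× ↪ k~`". [cite: MochizukiAbsTopIII2015, Definition 4.1 (iv) p.104] -/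
def iotaLogApp (P : HolTFPair 𝔄) : (lamTimes 𝔄).obj ((logFunctor 𝔄).obj P) ⟶ (lamSim 𝔄).obj P :=
  Hom.restrictTH (𝟙 P) (fun _ _ => Set.mem_univ _)

variable (𝔄) in
/-- **Def 4.1 (iv): `ι_log : λ^× ∘ 𝔩𝔬𝔤_{TF,TF} → λ^∼`**, in the shape required by `LogFrobeniusData`
(`(𝔩𝔬𝔤 ⋙ id_⋎) ⋙ λ^× ⟶ id_⋎ ⋙ λ^∼` with `id_⋎ = 𝟭`). [cite: MochizukiAbsTopIII2015, Definition 4.1 (iv) p.104] -/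
def iotaLog : (logFunctor 𝔄 ⋙ 𝟭 (HolTFPair 𝔄)) ⋙ lamTimes 𝔄 ⟶ 𝟭 (HolTFPair 𝔄) ⋙ lamSim 𝔄 where
  app P := iotaLogApp P
  naturality P Q φ := by
    apply HolTHPair.Hom.ext
    · change φ.base ≫ 𝟙 Q.X = 𝟙 P.X ≫ φ.base
      rw [Category.comp_id, Category.id_comp]
    · rfl

/-- **`ι_×` at a pair**: the morphism `λ^∼(𝕏 ↶ k) = (𝕏 ↶ k~) → (𝕏 ↶ k^×) = λ^×(𝕏 ↶ k)` "induced by the natural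
map `k~ ↠ k^×`" — the universal covering, realised as `exp_k` (`univCover`); a morphism of `𝒞^hol_TH`
since in the Kummer charts it is the complex exponential (holomorphic, nowhere-vanishing derivative).
[cite: MochizukiAbsTopIII2015, Definition 4.1 (iv) p.104] -/
def iotaTimesApp (P : HolTFPair 𝔄) : (lamSim 𝔄).obj P ⟶ (lamTimes 𝔄).obj P where
  base := 𝟙 P.X
  toFun x := @univCover P.k _ P.charZero_k x.1
  mem x := @IsCAF.univCover_ne_zero P.k _ P.charZero_k P.isCAF x.1
  hol e he he' := by
    haveI := P.charZero_k
    refine IsHolLocIso.of_eq_exp (((lamSim 𝔄).obj P).chart_injective _ e)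
      (((lamSim 𝔄).obj P).isOpen_chart_image _ e he he') (fun x => ?_)
    have hsymm : Continuous (P.κ.trans e).symm := P.continuous_κ_symm.comp he'
    have h := IsCAF.univCover_eq (P.κ.trans e) hsymm (x.1 : P.k)
    change e (𝔄.Amap (𝟙 P.X) (P.κ (univCover P.k x.1))) = Complex.exp (e (𝔄.Amap (𝟙 P.X) (P.κ x.1)))
    rw [𝔄.Amap_id_apply, 𝔄.Amap_id_apply, h]
    exact (P.κ.trans e).apply_symm_apply _

variable (𝔄) in
/-- **Def 4.1 (iv): `ι_× : λ^∼ → λ^×`** ("certain — but not all! — of the 'arrows' that appear in the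
archimedean case go in the opposite direction to the nonarchimedean case", Rmk 4.5.2), natural because
continuous field homomorphisms commute with the exponential.
[cite: MochizukiAbsTopIII2015, Definition 4.1 (iv) p.104] -/
def iotaTimes : lamSim 𝔄 ⟶ lamTimes 𝔄 where
  app P := iotaTimesApp P
  naturality P Q φ := by
    apply HolTHPair.Hom.ext
    · change φ.base ≫ 𝟙 Q.X = 𝟙 P.X ≫ φ.base
      rw [Category.comp_id, Category.id_comp]
    · funext x
      haveI := P.charZero_k
      haveI := Q.charZero_k
      change univCover Q.k (φ.arith x.1) = φ.arith (univCover P.k x.1)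
      exact (P.isCAF.map_univCover φ.arith φ.continuous_arith x.1).symm

end HolTFPair

namespace HolTHPair

variable (𝔄) in
/-- **The underlying arithmetic datum** `(𝕏 ↶ M) ↦ M`, `(φ_𝕏, φ_M) ↦ φ_M`, as a functor to types (the
"arithmetic data … of a 'typical object'" through which the proof of Cor 4.5 (iii), (iv) reads the
homotopies as maps `… ↪ k~_⋎ ↠ k^×_⋎ ↪ k~_{⋎+1} ↠ …`).
[cite: MochizukiAbsTopIII2015, Corollary 4.5 (iii) p.109] -/
def forget : HolTHPair 𝔄 ⥤ Type u where
  obj P := P.carrier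
  map φ := TypeCat.ofHom fun x => ⟨φ.toFun x, φ.mem x⟩

/-- The underlying-datum functor on morphisms is `φ_M`. [cite: MochizukiAbsTopIII2015, Corollary 4.5 (iii) p.109] -/
@[simp] theorem forget_map_apply_coe {P Q : HolTHPair 𝔄} (φ : P ⟶ Q) (x : P.carrier) :
    Subtype.val ((forget 𝔄).map φ x) = φ.toFun x := rfl

end HolTHPair

/-! ### Definition 4.1 (v): `LinHol` and `κ_LH` -/

/-- **Def 4.1 (v): an object of `LinHol`** — a pair `(𝕏, 𝕏 ↶^κ 𝒜_𝕏)` "consisting of an object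
`𝕏 ∈ Ob(EA)`, together with the tautological Kummer map `𝒜_𝕏 ⥲ 𝒜_𝕏` [i.e., given by the identity on the
object of `TF` determined by `𝒜_𝕏`] — all of which is to be understood as constructed via the algorithms
of Corollary 2.7 [cf. Remark 3.1.2]": the pair component is recorded WITH the equation saying it is the
tautological one (as in `AnabCategory.Anab`). [cite: MochizukiAbsTopIII2015, Definition 4.1 (v) p.105] -/
structure LinHolObj (𝔄 : AutHolFieldFunctor.{u}) : Type (u + 1) where
  /-- `𝕏 ∈ Ob(EA)`. -/
  X : 𝔄.EA
  /-- The pair `(𝕏 ↶ 𝒜_𝕏)` … -/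
  pair : HolTFPair 𝔄
  /-- … which IS the tautological one. -/
  pair_eq : pair = (HolTFPair.ofEA 𝔄).obj X

/-- **Def 4.1 (v): the category `LinHol`**, "whose morphisms are the morphisms induced by the [finite
étale] morphisms of `EA`" — Mathlib's `InducedCategory` along `(𝕏, 𝕏 ↶ 𝒜_𝕏) ↦ 𝕏`.
[cite: MochizukiAbsTopIII2015, Definition 4.1 (v) p.105] -/
abbrev LinHol (𝔄 : AutHolFieldFunctor.{u}) : Type (u + 1) :=
  InducedCategory 𝔄.EA (fun P : LinHolObj 𝔄 => P.X)

namespace LinHol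

variable (𝔄)

/-- The natural projection `LinHol → EA`. [cite: MochizukiAbsTopIII2015, Definition 4.1 (v) p.105] -/
def proj : LinHol 𝔄 ⥤ 𝔄.EA := inducedFunctor _

/-- **Def 4.1 (v): the natural functor `κ_LH : EA → LinHol`**, `𝕏 ↦ (𝕏, 𝕏 ↶ 𝒜_𝕏)`.
[cite: MochizukiAbsTopIII2015, Definition 4.1 (v) p.105] -/
def κLH : 𝔄.EA ⥤ LinHol 𝔄 where
  obj X := ⟨X, (HolTFPair.ofEA 𝔄).obj X, rfl⟩
  map f := InducedCategory.homMk f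

variable {𝔄} in
/-- Every object of `LinHol` is `κ_LH` of its structure-orbispace, canonically.
[cite: MochizukiAbsTopIII2015, Definition 4.1 (v) p.105] -/
def isoκLHProj (P : LinHol 𝔄) : (κLH 𝔄).obj P.X ≅ P :=
  InducedCategory.isoMk (Iso.refl _)

/-- **Def 4.1 (v): `κ_LH : EA ⥲ LinHol` "is an equivalence of categories, a quasi-inverse for which is
given by the natural projection functor `LinHol → EA`"** ("as is easily verified" — verified).
[cite: MochizukiAbsTopIII2015, Definition 4.1 (v) p.105] -/
def linHolEquivalence : 𝔄.EA ≌ LinHol 𝔄 where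
  functor := κLH 𝔄
  inverse := proj 𝔄
  unitIso := Iso.refl _
  counitIso := NatIso.ofComponents (isoκLHProj (𝔄 := 𝔄)) (fun {P Q} f => by
    apply InducedCategory.hom_ext
    change f.hom ≫ 𝟙 Q.X = 𝟙 P.X ≫ f.hom
    rw [Category.comp_id, Category.id_comp])
  functor_unitIso_comp X := by
    apply InducedCategory.hom_ext
    change 𝟙 X ≫ 𝟙 X = 𝟙 X
    exact Category.id_comp _

/-- `κ_LH` is an equivalence. [cite: MochizukiAbsTopIII2015, Definition 4.1 (v) p.105] -/
theorem κLH_isEquivalence : (κLH 𝔄).IsEquivalence := (linHolEquivalence 𝔄).isEquivalence_functor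

/-- The projection `LinHol → EA` is an equivalence. [cite: MochizukiAbsTopIII2015, Definition 4.1 (v) p.105] -/
theorem proj_isEquivalence : (proj 𝔄).IsEquivalence := (linHolEquivalence 𝔄).isEquivalence_inverse

/-- `κ_LH ⋙ proj ≅ 𝟭` (the shape `LogFrobeniusData.κ_inv`). [cite: MochizukiAbsTopIII2015, Definition 4.1 (v) p.105] -/
def κLH_inv : κLH 𝔄 ⋙ proj 𝔄 ≅ 𝟭 𝔄.EA := Iso.refl _

/-! ### Corollary 4.5 (ii): `φ_LH`, `η_LH` -/

/-- **Cor 4.5 (ii): the forgetful functor `φ_LH : LinHol → 𝒳`**, "`(𝕏, 𝕏 ↶ 𝒜_𝕏) ↦ (𝕏 ↶ 𝒜_𝕏)`", on morphisms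
the lift of the inducing finite étale morphism (arithmetic part `𝒜_φ`).
[cite: MochizukiAbsTopIII2015, Corollary 4.5 (ii) p.108] -/
def φLH : LinHol 𝔄 ⥤ HolTFPair 𝔄 := proj 𝔄 ⋙ HolTFPair.ofEA 𝔄

/-- **Cor 4.5 (ii)**: `φ_LH` "is an equivalence of categories" (composite of the equivalences `proj` and
`𝕏 ↦ (𝕏 ↶ 𝒜_𝕏)`). [cite: MochizukiAbsTopIII2015, Corollary 4.5 (ii) p.108] -/
theorem φLH_isEquivalence : (φLH 𝔄).IsEquivalence :=
  haveI := proj_isEquivalence 𝔄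
  haveI := HolTFPair.ofEA_isEquivalence 𝔄
  Functor.isEquivalence_trans (proj 𝔄) (HolTFPair.ofEA 𝔄)

/-- **Cor 4.5 (ii): `π_LH : 𝒳 → LinHol`**, "the composite … of the natural projection functor `𝒳 → EA`
with `κ_LH`". [cite: MochizukiAbsTopIII2015, Corollary 4.5 (ii) p.108] -/
def πLH : HolTFPair 𝔄 ⥤ LinHol 𝔄 := HolTFPair.toEA 𝔄 ⋙ κLH 𝔄

/-- **Cor 4.5 (ii): `η_LH : φ_LH ∘ π_LH ⥲ id_𝒳`**, "the tautological isomorphism arising from the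
definitions": at `(𝕏 ↶ k)` the isomorphism `(𝕏 ↶ 𝒜_𝕏) ⥲ (𝕏 ↶ k)` given by `κ⁻¹`; typed in the shape
`((𝒳 → EA) ⋙ κ_LH) ⋙ φ_LH ≅ 𝟭_𝒳` of `LogFrobeniusData.η`.
[cite: MochizukiAbsTopIII2015, Corollary 4.5 (ii) p.108] -/
def ηLH : (HolTFPair.toEA 𝔄 ⋙ κLH 𝔄) ⋙ φLH 𝔄 ≅ 𝟭 (HolTFPair 𝔄) :=
  NatIso.ofComponents (fun P => HolTFPair.etaIso P) (fun {P Q} φ => by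
    apply HolTFPair.Hom.ext_of_base
    change φ.base ≫ 𝟙 Q.X = 𝟙 P.X ≫ φ.base
    rw [Category.comp_id, Category.id_comp])

end LinHol

/-! ### The input data of Corollary 4.5 -/

variable (𝔄)

/-- **The archimedean input data of Cor 4.5** as a `LogFrobeniusData`: "`𝒳 := 𝒞^hol_T` …, `ℰ := EA`,
`𝒩 := 𝒞^hol_TH` … [`T = TF`]", first row `= 𝒳` with `id_⋎` the identity functor, `log = 𝔩𝔬𝔤_{T,T}` (the
identity in this realisation, `logIsoId` the identity isomorphism), `λ^×`, `λ^∼`, `ι_log`, and `ι_×` in the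
RIGHT summand (`λ^∼ → λ^×`, Rmk 4.5.2), the projections to `EA`, `κ_LH : EA ⥲ LinHol` with quasi-inverse
the projection, `φ_LH`, `η_LH`.  SCOPE (visible here on purpose): `𝒩` is `HolTHPair 𝔄`, i.e. print's
`𝒞^hol_TH` RESTRICTED to arithmetic data presented inside CAFs (the essential image of `λ^×`, `λ^∼`, which
is all Cor 4.5 meets) — not the full printed `𝒞^hol_TH`; `T = TF` only.
-- TODO(general form): `𝒩 = 𝒞^hol_TH` with arbitrary connected Aut-holomorphic orbispaces; `T = TM`.
[cite: MochizukiAbsTopIII2015, Corollary 4.5 pp.107–108] -/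
def archLogFrobeniusData : LogFrobeniusData.{u + 1} where
  X₁ := HolTFPair 𝔄
  X := HolTFPair 𝔄
  toNexus := 𝟭 _
  N := HolTHPair 𝔄
  E := 𝔄.EA
  A := LinHol 𝔄
  log := HolTFPair.logFunctor 𝔄
  logIsoId := Iso.refl _
  lamTimes := HolTFPair.lamTimes 𝔄
  lamPf := HolTFPair.lamSim 𝔄
  ιlog := HolTFPair.iotaLog 𝔄
  ιtimes := Sum.inr (HolTFPair.iotaTimes 𝔄)
  XtoE := HolTFPair.toEA 𝔄
  NtoE := HolTHPair.toEA 𝔄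
  lamTimes_NtoE := rfl
  lamPf_NtoE := rfl
  κ := LinHol.κLH 𝔄
  AtoE := LinHol.proj 𝔄
  κ_equiv := LinHol.κLH_isEquivalence 𝔄
  κ_inv := LinHol.κLH_inv 𝔄
  φ := LinHol.φLH 𝔄
  φ_equiv := LinHol.φLH_isEquivalence 𝔄
  η := LinHol.ηLH 𝔄

/-- The archimedean data is of Aut-holomorphic type: `ι_×` is the right summand.
[cite: MochizukiAbsTopIII2015, Remark 4.5.2 p.111] -/
theorem archLogFrobeniusData_ιtimes :
    (archLogFrobeniusData 𝔄).ιtimes = Sum.inr (HolTFPair.iotaTimes 𝔄) := rfl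

/-- **The first-row telecore data of Cor 4.5 (ii)**, `⟨φ_LH, unitor, η_LH⟩`: telecore edges
`φ_⋏ = φ_LH : LinHol → 𝒳` at every vertex of the first row, `id_⋎ ∘ φ_⋎ ≅ φ_□` the unit isomorphism
(`η_{□⋎}` "the identity natural transformation"), and `η_⋏ = η_LH`.
[cite: MochizukiAbsTopIII2015, Corollary 4.5 (ii) p.108] -/
def archTelecoreData : (archLogFrobeniusData 𝔄).TelecoreData where
  φ₁ := LinHol.φLH 𝔄
  e := (LinHol.φLH 𝔄).rightUnitor
  η₁ := NatIso.ofComponents (fun P => HolTFPair.etaIso P) (fun {P Q} φ => by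
    apply HolTFPair.Hom.ext_of_base
    change HolTFPair.Hom.base φ ≫ 𝟙 (HolTFPair.X Q) = 𝟙 (HolTFPair.X P) ≫ HolTFPair.Hom.base φ
    rw [Category.comp_id, Category.id_comp])

end Literature.AnabelianGeometry.AbsoluteAnabelian

end
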